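import Mathlib
import Literature.Geometry.DiscreteGeometry.TwoShellPatterns
import Summits.AtomisticToContinuum.Crystallization.Theorems.PhononSlackCertificatesNearFarGlueRCoverHcp

/-!
# Crux `NearFarGlueR` (stmt-AtomisticToContinuum-14970), line `Sketch`: stub `stub_coverHcpSharp`

The sharp(er) covering constant of the hcp first shell: the twelve first-shell directions of the
hcp two-shell pattern (the anticuboctahedron `hcpKissingPattern ⊆ hcpTwoShellPattern`)
`2/3`-cover the unit sphere — for every unit vector `w` there is a first-shell (unit) pattern
vector `v` with `⟪v, w⟫ ≥ 2/3` (the true optimum is `1/√2`; the line only needs `2/3`).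

Proof (explicit selection rule).  Work in the integer model `hcpInt` (scale `(√18)⁻¹`), which is
invariant under all permutations of the three coordinates; so first sort the coordinates of `w`
by absolute value, `|x| ≥ |y| ≥ |z|`, `x² + y² + z² = 1` (`coverHcpSharp_sorted`), and choose
`u ∈ hcpInt` with `f = u ⬝ (x, y, z) ≥ 0` and `f² ≥ 8` (then `f/√18 ≥ 2√2/√18 = 2/3`,
`coverHcpSharp_bound`):
* not both `x, y` negative: `u = (±3, ±3, 0)` with the signs of `x, y` (a mixed pair is an
  in-plane vector, `(+,+)` an upper-cap vector), `f = 3(|x| + |y|)`, `f² ≥ 9` as `|x||y| ≥ z²`;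
* `x, y < 0`, `z ≤ 0`: `u = (-4, -1, -1)`, `f = 4|x| + |y| + |z|`, `f² ≥ 9`;
* `x, y < 0 < z`, `|x| ≤ 2z`: `u = (-3, 0, 3)`, `f = 3(|x| + z)`, `f² ≥ 9` as `2|x|z ≥ x² ≥ y²`;
* `x, y < 0 < z`, `2z ≤ |x|`: `u = (-4, -1, -1)`, `f = 4|x| + |y| - z ≥ (7/2)|x| + |y|`, `f² ≥ 8`.
The general case is reduced to the sorted one by one of the six coordinate permutations
(`coverHcpSharp_perm`, membership in `hcpInt` of the permuted vector by `decide`), and the chosen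
integer vector is turned into a pattern vector by the landed helpers of stub `stub_coverHcp`
(`coverHcp_inner`, `hcpKissingPattern_subset`, `norm_eq_one_of_mem_hcpKissingPattern`).
-/

noncomputable section

namespace Summit.AtomisticToContinuum.Crystallization.Theorems.PhononSlackCertificatesNearFarGlueR

open Literature.Geometry.DiscreteGeometry
open scoped BigOperators RealInnerProductSpace

/-- The final numerical step: `0 ≤ f` and `8 ≤ f²` give `2/3 ≤ f/√18` (as `(2/3)·√18 = 2√2`).
[folklore] -/
theorem coverHcpSharp_bound (f : ℝ) (hf0 : 0 ≤ f) (hf8 : 8 ≤ f ^ 2) :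
    (2 / 3 : ℝ) ≤ (Real.sqrt 18)⁻¹ * f := by
  have hs : 0 < Real.sqrt 18 := by positivity
  have h18 : Real.sqrt 18 ^ 2 = 18 := Real.sq_sqrt (by norm_num)
  rw [inv_mul_eq_div, le_div_iff₀ hs]
  nlinarith [mul_pos hs hs, mul_nonneg hf0 hs.le]

/-- `hcpInt` is invariant under the permutations of the three coordinates: the five non-trivial
coordinate permutations of a vector of `hcpInt` lie in `hcpInt`. [folklore] -/
theorem coverHcpSharp_perm {a b d : ℤ} (h : ![a, b, d] ∈ hcpInt) :
    ![b, a, d] ∈ hcpInt ∧ ![a, d, b] ∈ hcpInt ∧ ![d, b, a] ∈ hcpInt ∧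
      ![b, d, a] ∈ hcpInt ∧ ![d, a, b] ∈ hcpInt := by
  have key : ∀ u ∈ hcpInt, ![u 1, u 0, u 2] ∈ hcpInt ∧ ![u 0, u 2, u 1] ∈ hcpInt ∧
      ![u 2, u 1, u 0] ∈ hcpInt ∧ ![u 1, u 2, u 0] ∈ hcpInt ∧ ![u 2, u 0, u 1] ∈ hcpInt := by
    decide
  exact key _ h

/-- **The sorted case.**  If `x² + y² + z² = 1` and `|x| ≥ |y| ≥ |z|`, some `(a, b, d) ∈ hcpInt`
has `(a x + b y + d z)/√18 ≥ 2/3`: by the explicit four-branch selection rule described in the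
module docstring (signs of `x, y`, then sign of `z`, then `|x| ≤ 2z` or `2z ≤ |x|`). [folklore] -/
theorem coverHcpSharp_sorted (x y z : ℝ) (hsum : x ^ 2 + y ^ 2 + z ^ 2 = 1)
    (hxy : |y| ≤ |x|) (hyz : |z| ≤ |y|) :
    ∃ a b d : ℤ, ![a, b, d] ∈ hcpInt ∧
      (2 / 3 : ℝ) ≤ (Real.sqrt 18)⁻¹ * (a * x + b * y + d * z) := by
  have hz2 : |z| ^ 2 = z ^ 2 := sq_abs z
  have hz0 : 0 ≤ |z| := abs_nonneg z
  rcases le_or_gt 0 x with hx | hx <;> rcases le_or_gt 0 y with hy | hy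
  · -- Branch 1, signs `(+, +)`: `u = (3, 3, 0)`, `f = 3 (|x| + |y|)`.
    rw [abs_of_nonneg hx] at hxy
    rw [abs_of_nonneg hy] at hxy hyz
    refine ⟨3, 3, 0, by decide, coverHcpSharp_bound _ ?_ ?_⟩ <;> push_cast
    · linarith
    · nlinarith [mul_le_mul hyz hyz hz0 hy, mul_le_mul_of_nonneg_right hxy hy]
  · -- Branch 1, signs `(+, -)`: `u = (3, -3, 0)`, `f = 3 (|x| + |y|)`.
    have hy' : 0 ≤ -y := by linarith
    rw [abs_of_nonneg hx] at hxy
    rw [abs_of_neg hy] at hxy hyz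
    refine ⟨3, -3, 0, by decide, coverHcpSharp_bound _ ?_ ?_⟩ <;> push_cast
    · linarith
    · nlinarith [mul_le_mul hyz hyz hz0 hy', mul_le_mul_of_nonneg_right hxy hy']
  · -- Branch 1, signs `(-, +)`: `u = (-3, 3, 0)`, `f = 3 (|x| + |y|)`.
    have hx' : 0 ≤ -x := by linarith
    rw [abs_of_neg hx] at hxy
    rw [abs_of_nonneg hy] at hxy hyz
    refine ⟨-3, 3, 0, by decide, coverHcpSharp_bound _ ?_ ?_⟩ <;> push_cast
    · linarith
    · nlinarith [mul_le_mul hyz hyz hz0 hy, mul_le_mul_of_nonneg_right hxy hy]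
  · -- The two largest coordinates are negative.
    have hx' : 0 ≤ -x := by linarith
    have hy' : 0 ≤ -y := by linarith
    rw [abs_of_neg hx, abs_of_neg hy] at hxy
    rw [abs_of_neg hy] at hyz
    rcases le_or_gt z 0 with hz | hz
    · -- Branch 2, `z ≤ 0`: `u = (-4, -1, -1)`, `f = 4|x| + |y| + |z|`.
      have hz' : 0 ≤ -z := by linarith
      rw [abs_of_nonpos hz] at hyz
      refine ⟨-4, -1, -1, by decide, coverHcpSharp_bound _ ?_ ?_⟩ <;> push_cast
      · linarith
      · nlinarith [mul_le_mul_of_nonneg_right hxy hy',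
          mul_le_mul_of_nonneg_right (hyz.trans hxy) hz', mul_nonneg hy' hz']
    · rw [abs_of_pos hz] at hyz
      rcases le_total (-x) (2 * z) with h2 | h2
      · -- Branch 3, `0 < z`, `|x| ≤ 2z`: `u = (-3, 0, 3)`, `f = 3 (|x| + z)`.
        refine ⟨-3, 0, 3, by decide, coverHcpSharp_bound _ ?_ ?_⟩ <;> push_cast
        · linarith
        · nlinarith [mul_le_mul_of_nonneg_left h2 hx', mul_le_mul hxy hxy hy' hx']
      · -- Branch 4, `0 < z`, `2z ≤ |x|`: `u = (-4, -1, -1)`, `f = 4|x| + |y| - z`.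
        refine ⟨-4, -1, -1, by decide, coverHcpSharp_bound _ ?_ ?_⟩ <;> push_cast
        · linarith
        · nlinarith [mul_le_mul_of_nonneg_right hxy hy', mul_le_mul_of_nonneg_left h2 hx',
            mul_le_mul_of_nonneg_left hyz hy', mul_le_mul h2 h2 (by positivity) hx',
            mul_le_mul hxy hxy hy' hx', sq_nonneg x]

/-- From an integer vector `(a, b, d) ∈ hcpInt` with `(a w₀ + b w₁ + d w₂)/√18 ≥ 2/3` to the
pattern vector `v = (a, b, d)/√18 ∈ hcpKissingPattern ⊆ hcpTwoShellPattern`, of norm `1`, with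
`⟪v, w⟫ ≥ 2/3` (by the landed helpers of stub `stub_coverHcp`). [folklore] -/
theorem coverHcpSharp_finish (w : EuclideanSpace ℝ (Fin 3)) (a b d : ℤ)
    (hu : ![a, b, d] ∈ hcpInt)
    (h : (2 / 3 : ℝ) ≤ (Real.sqrt 18)⁻¹ * (a * w 0 + b * w 1 + d * w 2)) :
    ∃ v ∈ hcpTwoShellPattern, ‖v‖ = 1 ∧ (2 / 3 : ℝ) ≤ ⟪v, w⟫ := by
  have hmem : (Real.sqrt 18)⁻¹ • intVec ![a, b, d] ∈ hcpKissingPattern :=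
    Finset.mem_image_of_mem _ hu
  exact ⟨_, hcpKissingPattern_subset hmem, norm_eq_one_of_mem_hcpKissingPattern hmem,
    by rwa [coverHcp_inner]⟩

/-- **The anticuboctahedron directions `2/3`-cover the sphere** (stub `stub_coverHcpSharp` of line
`Sketch` of crux `NearFarGlueR`): for every unit vector `w` of `ℝ³` some unit vector `v` of the
hcp two-shell pattern has `⟪v, w⟫ ≥ 2/3`.  Sort the coordinates of `w` by absolute value (six
orderings), apply the sorted case `coverHcpSharp_sorted`, and permute the integer vector back
(`coverHcpSharp_perm`). [folklore] -/
theorem stub_coverHcpSharp :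
    ∀ w : EuclideanSpace ℝ (Fin 3), ‖w‖ = 1 →
      ∃ v ∈ hcpTwoShellPattern, ‖v‖ = 1 ∧ (2 / 3 : ℝ) ≤ ⟪v, w⟫ := by
  intro w hw
  have hw2 : w 0 ^ 2 + w 1 ^ 2 + w 2 ^ 2 = 1 := by
    have hsq := EuclideanSpace.real_norm_sq_eq w
    rw [hw, one_pow, Fin.sum_univ_three] at hsq
    linarith
  rcases le_total |w 1| |w 0| with h01 | h01
  · rcases le_total |w 2| |w 1| with h12 | h12
    · -- `|w 0| ≥ |w 1| ≥ |w 2|`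
      obtain ⟨a, b, d, hu, h⟩ := coverHcpSharp_sorted (w 0) (w 1) (w 2) hw2 h01 h12
      exact coverHcpSharp_finish w a b d hu h
    · rcases le_total |w 2| |w 0| with h02 | h02
      · -- `|w 0| ≥ |w 2| ≥ |w 1|`
        obtain ⟨a, b, d, hu, h⟩ :=
          coverHcpSharp_sorted (w 0) (w 2) (w 1) (by rw [← hw2]; ring) h02 h12
        exact coverHcpSharp_finish w a d b (coverHcpSharp_perm hu).2.1 (h.trans_eq (by ring))
      · -- `|w 2| ≥ |w 0| ≥ |w 1|`
        obtain ⟨a, b, d, hu, h⟩ :=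
          coverHcpSharp_sorted (w 2) (w 0) (w 1) (by rw [← hw2]; ring) h02 h01
        exact coverHcpSharp_finish w b d a (coverHcpSharp_perm hu).2.2.2.1
          (h.trans_eq (by ring))
  · rcases le_total |w 2| |w 0| with h02 | h02
    · -- `|w 1| ≥ |w 0| ≥ |w 2|`
      obtain ⟨a, b, d, hu, h⟩ :=
        coverHcpSharp_sorted (w 1) (w 0) (w 2) (by rw [← hw2]; ring) h01 h02
      exact coverHcpSharp_finish w b a d (coverHcpSharp_perm hu).1 (h.trans_eq (by ring))
    · rcases le_total |w 2| |w 1| with h12 | h12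
      · -- `|w 1| ≥ |w 2| ≥ |w 0|`
        obtain ⟨a, b, d, hu, h⟩ :=
          coverHcpSharp_sorted (w 1) (w 2) (w 0) (by rw [← hw2]; ring) h12 h02
        exact coverHcpSharp_finish w d a b (coverHcpSharp_perm hu).2.2.2.2
          (h.trans_eq (by ring))
      · -- `|w 2| ≥ |w 1| ≥ |w 0|`
        obtain ⟨a, b, d, hu, h⟩ :=
          coverHcpSharp_sorted (w 2) (w 1) (w 0) (by rw [← hw2]; ring) h12 h01
        exact coverHcpSharp_finish w d b a (coverHcpSharp_perm hu).2.2.1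
          (h.trans_eq (by ring))

end Summit.AtomisticToContinuum.Crystallization.Theorems.PhononSlackCertificatesNearFarGlueR
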